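import Mathlib.FieldTheory.IntermediateField.Adjoin.Basic
import Mathlib.RingTheory.Polynomial.Eisenstein.Criterion
import Mathlib.FieldTheory.Finite.Basic
import Literature.NumberTheory.GaloisRepresentations.LubinTate
import Literature.NumberTheory.GaloisRepresentations.LocalExistenceLubinTate
import Literature.NumberTheory.GaloisRepresentations.LocalGaloisGroupProofs
import HarnessLib

/-!
# The Lubin–Tate fields `K_π^n`: the polynomials `f^{(n)}`, `φ_n`, the degree, and `π ∈ N(K_π^n)`

Step P2 (first half) of the programme of `LocalExistenceLubinTate.lean` towards the norm-group fact
`Literature.NumberTheory.GaloisRepresentations.exists_abelian_norm_le_lubinTate` (`N(K_π^nˣ) ⊆ ⟨π⟩ · U^{(n)}`, Cassels–Fröhlich VI §3.6,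
§3.8), for a non-archimedean local field `F` with uniformizer `π` and residue field of `q`
elements, and the simplest Lubin–Tate series `f = πX + X^q` (Cassels–Fröhlich VI §3.3, Example
(a); §3.6, proof of Prop. 6).  Everything here is **proved**:

* `Literature.NumberTheory.GaloisRepresentations.isLTRing_integer` — `(𝒪[F], π, q)` satisfies the hypotheses `Literature.NumberTheory.GaloisRepresentations.LubinTate.IsLTRing` of
  Lubin–Tate's lemma (`LubinTate.lean`): `𝒪[F]` is a domain, `1 - π^m` are units, `q = p^r` with
  `p = char 𝓀[F] ∈ (π)`, and `a^q ≡ a (mod π)`; `Literature.NumberTheory.GaloisRepresentations.isLTSeries_ltPoly` — `f = πX + X^q ∈ 𝔉_π`.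
* `Literature.ltPolyIter F π n = f^{(n)}` and `Literature.ltPolyDiv F π n = φ_{n+1} = (f^{(n)})^{q-1} + π`, with
  `f^{(n+1)} = f^{(n)} · φ_{n+1}` (`ltPolyIter_succ_eq_mul`), `f^{(n)} ≡ X^{q^n} (mod 𝓂)`,
  `f^{(n)}` monic of degree `q^n` without constant term, `φ_{n+1}` monic of degree `(q-1)q^n` with
  constant term `π` and `≡ X^{(q-1)q^n} (mod 𝓂)` — an **Eisenstein polynomial**, irreducible over
  `F` (`irreducible_map_ltPolyDiv`; Cassels–Fröhlich VI §3.6, proof of Prop. 6).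
* `Literature.ltRoot π n = λ_{n+1}`, a root in `F̄` of `φ_{n+1}` (a primitive `π^{n+1}`-division point),
  and `Literature.ltField π n = K_π^{n+1} := F(λ_{n+1}) ⊆ F̄` with
  **`[K_π^{n+1} : F] = (q-1)q^n`** (`finrank_ltField`) and **`N(-λ_{n+1}) = π`**, so
  `π ∈ N(K_π^{n+1}ˣ)` (`norm_neg_gen_ltField`, `mem_range_norm_ltField`; Cassels–Fröhlich VI §3.6,
  Cor. to Prop. 6).

These are the conjuncts "degree" and "`π ∈ N(Eˣ)`" of `exists_abelian_norm_le_lubinTate` at every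
level; the remaining conjuncts (`K_π^{n+1}/F` abelian — via the `𝒪`-module of division points,
Cassels–Fröhlich VI §3.6 Prop. 6 (b) — and `N(K_π^{n+1}ˣ) ⊆ ⟨π⟩ · U^{(n+1)}` — Coleman's norm
operator, de Shalit I §2.1) need the evaluation of the Lubin–Tate series at division points and are
left to the sequel.  (That `F(λ_{n+1}) = F(E_f^{n+1})`, i.e. that all `π^{n+1}`-division points lie
in `F(λ_{n+1})`, is part of that sequel; here `K_π^{n+1}` *denotes* `F(λ_{n+1})`.)

## References

* J.-P. Serre, *Local class field theory*, Ch. VI in Cassels–Fröhlich, *Algebraic Number Theory*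
  (1967): §3.3 Example (a) (`f = πX + X^q`), §3.6 Prop. 6 and its proof, Cor. (PDF pp. 191,
  194–195 of the held copy).  [CasselsFrohlichANT1967]
* J. Lubin, J. Tate, *Formal complex multiplication in local fields*, Ann. of Math. 81 (1965),
  p. 380 (`f(T) = πT + T^q`), §1.  [LubinTate1965]
* J.-P. Serre, *Local Fields* (1979), Ch. I §6 Prop. 17 (Eisenstein polynomials).
  [SerreLocalFields1979]

## Mathlib reuse

`Polynomial.comp`, `Polynomial.Monic.comp`, `irreducible_of_eisenstein_criterion`,
`Polynomial.Monic.irreducible_iff_irreducible_map_fraction_map`, `IsAlgClosed.exists_aeval_eq_zero`,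
`IntermediateField.adjoin.powerBasis`, `Algebra.PowerBasis.norm_gen_eq_coeff_zero_minpoly`,
`FiniteField.pow_card`, `CharP.char_is_prime`; from the tree: `Literature.LubinTate.IsLTRing/IsLTSeries`
(`LubinTate.lean`), `Literature.NumberTheory.GaloisRepresentations.unifValue` API (`LocalExistenceLubinTate.lean`),
`Literature.NumberTheory.GaloisRepresentations.IsNonarchimedeanLocalField.residueFieldCard_eq_pow_ringChar`,
`mem_maximalIdeal_iff_valuation_lt_one` (`LocalField.lean`, `LocalGaloisGroupProofs.lean`).
-/

noncomputable section

open ValuativeRel Valuation Polynomial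

namespace Literature.NumberTheory.GaloisRepresentations

/-! ### The valuation ring of a local field is an LT ring -/

section LocalField

open GaloisRepresentations.IsNonarchimedeanLocalField LubinTate

variable (F : Type*) [Field F] [ValuativeRel F] [TopologicalSpace F] [IsNonarchimedeanLocalField F]

/-- `x ∈ 𝓂[F]` is divisible by any uniformizer. [folklore] -/
theorem dvd_of_mem_maximalIdeal {π : 𝒪[F]} (hπ : (valuation F).IsUniformizer (π : F)) {x : 𝒪[F]}
    (hx : x ∈ 𝓂[F]) : π ∣ x := by
  rw [mem_maximalIdeal_iff_valuation_lt_one] at hx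
  have hle : valuation F (x : F) ≤ valuation F (π : F) := by
    rw [show valuation F (π : F) = unifValue F from hπ]
    exact (valuation_le_unifValue_iff_lt_one F _).mpr hx
  exact (Valuation.Integers.le_iff_dvd (Valuation.integer.integers (valuation F))).mp hle

/-- **The valuation ring of a non-archimedean local field satisfies the Lubin–Tate hypotheses**
for a uniformizer `π` and `q = #𝓀[F]`.
[cite: CasselsFrohlichANT1967, Ch. VI §3.5 Prop. 5, Remark 2] -/
theorem isLTRing_integer {π : 𝒪[F]} (hπ : (valuation F).IsUniformizer (π : F)) :
    IsLTRing π (residueFieldCard F) := by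
  classical
  have hπm : π ∈ 𝓂[F] := (mem_maximalIdeal_iff_valuation_lt_one _).mpr hπ.val_lt_one
  refine ⟨fun x hx => ?_, fun m hm => ?_, ?_, fun a => ?_⟩
  · rcases mul_eq_zero.mp hx with h | h
    · exact absurd (congrArg Subtype.val h) hπ.ne_zero
    · exact h
  · by_contra hu
    have hmem : 1 - π ^ m ∈ 𝓂[F] := (IsLocalRing.mem_maximalIdeal _).mpr hu
    have : (1 : 𝒪[F]) ∈ 𝓂[F] := by
      have h := Ideal.add_mem _ hmem (Ideal.pow_mem_of_mem 𝓂[F] hπm m hm)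
      rwa [sub_add_cancel] at h
    exact (IsLocalRing.maximalIdeal.isMaximal 𝒪[F]).ne_top
      (Ideal.eq_top_of_isUnit_mem _ this isUnit_one)
  · obtain ⟨r, hr, hq⟩ := residueFieldCard_eq_pow_ringChar F
    letI : Fintype 𝓀[F] := Fintype.ofFinite _
    haveI : Fact (ringChar 𝓀[F]).Prime := ⟨CharP.char_is_prime 𝓀[F] _⟩
    refine ⟨ringChar 𝓀[F], r, Fact.out, hq, ?_⟩
    rw [Ideal.mem_span_singleton]
    refine dvd_of_mem_maximalIdeal F hπ ?_
    rw [← IsLocalRing.residue_eq_zero_iff, map_natCast]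
    exact ringChar.Nat.cast_ringChar
  · refine dvd_of_mem_maximalIdeal F hπ ?_
    rw [← IsLocalRing.residue_eq_zero_iff, _root_.map_sub, map_pow, sub_eq_zero]
    letI : Fintype 𝓀[F] := Fintype.ofFinite _
    have hcard : Fintype.card 𝓀[F] = residueFieldCard F := by
      rw [residueFieldCard, Nat.card_eq_fintype_card]
    rw [← hcard, FiniteField.pow_card]

/-- The Lubin–Tate polynomial `f = π X + X^q`.
[cite: CasselsFrohlichANT1967, Ch. VI §3.3 Example (a)] -/
def ltPoly (π : 𝒪[F]) : 𝒪[F][X] := C π * X + X ^ residueFieldCard F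

/-- `f = πX + X^q ∈ 𝔉_π` (as a power series).
[cite: CasselsFrohlichANT1967, Ch. VI §3.3 Example (a)] -/
theorem isLTSeries_ltPoly {π : 𝒪[F]} :
    IsLTSeries π (residueFieldCard F) ((ltPoly F π : 𝒪[F][X]) : PowerSeries 𝒪[F]) := by
  have hq : 1 < residueFieldCard F := one_lt_residueFieldCard F
  have hq0 : residueFieldCard F ≠ 0 := by omega
  have hq1 : residueFieldCard F ≠ 1 := by omega
  have hcoeff : ∀ n, PowerSeries.coeff n ((ltPoly F π : 𝒪[F][X]) : PowerSeries 𝒪[F]) =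
      (if n = 1 then π else 0) + (if n = residueFieldCard F then 1 else 0) := fun n => by
    rw [Polynomial.coeff_coe, ltPoly, coeff_add, coeff_C_mul, coeff_X_pow, coeff_X]
    by_cases h1 : n = 1
    · subst h1; simp
    · rw [if_neg (Ne.symm h1), if_neg h1, mul_zero]
  refine ⟨?_, ?_, fun n => ?_⟩
  · rw [← PowerSeries.coeff_zero_eq_constantCoeff_apply, hcoeff, if_neg zero_ne_one,
      if_neg (Ne.symm hq0), add_zero]
  · rw [hcoeff, if_pos rfl, if_neg (Ne.symm hq1), add_zero]
  · rw [hcoeff, add_sub_cancel_right]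
    split_ifs
    · exact dvd_rfl
    · exact dvd_zero _

/-- The iterates `f^{(n)} = f ∘ ⋯ ∘ f` of the Lubin–Tate polynomial.
[cite: CasselsFrohlichANT1967, Ch. VI §3.6 Prop. 6 (proof)] -/
def ltPolyIter (π : 𝒪[F]) : ℕ → 𝒪[F][X]
  | 0 => X
  | n + 1 => (ltPoly F π).comp (ltPolyIter π n)

/-- The polynomial `φ_{n+1} = (f^{(n)})^{q-1} + π = f^{(n+1)} / f^{(n)}`.
[cite: CasselsFrohlichANT1967, Ch. VI §3.6 Prop. 6 (proof)] -/
def ltPolyDiv (π : 𝒪[F]) (n : ℕ) : 𝒪[F][X] := ltPolyIter F π n ^ (residueFieldCard F - 1) + C π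

variable {F}
variable (π : 𝒪[F])

/-- `f^{(0)} = X`. [folklore] -/
theorem ltPolyIter_zero : ltPolyIter F π 0 = X := rfl

/-- `f^{(n+1)} = f ∘ f^{(n)}`. [folklore] -/
theorem ltPolyIter_succ (n : ℕ) : ltPolyIter F π (n + 1) = (ltPoly F π).comp (ltPolyIter F π n) :=
  rfl

/-- `f^{(n+1)} = f^{(n)} · φ_{n+1}`. [cite: CasselsFrohlichANT1967, Ch. VI §3.6 Prop. 6 (proof)] -/
theorem ltPolyIter_succ_eq_mul (n : ℕ) :
    ltPolyIter F π (n + 1) = ltPolyIter F π n * ltPolyDiv F π n := by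
  have hq : 1 ≤ residueFieldCard F := (one_lt_residueFieldCard F).le
  rw [ltPolyIter_succ, ltPoly, ltPolyDiv, add_comp, mul_comp, C_comp, X_comp, X_pow_comp]
  conv_lhs => rw [← Nat.sub_add_cancel hq, pow_succ]
  ring

/-- `f ≡ X^q (mod 𝓂)`. [cite: CasselsFrohlichANT1967, Ch. VI §3.3] -/
theorem map_residue_ltPoly (hπ : π ∈ 𝓂[F]) :
    (ltPoly F π).map (IsLocalRing.residue 𝒪[F]) = X ^ residueFieldCard F := by
  rw [ltPoly, Polynomial.map_add, Polynomial.map_mul, map_C, map_X, Polynomial.map_pow, map_X,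
    (IsLocalRing.residue_eq_zero_iff π).mpr hπ, C_0, zero_mul, zero_add]

/-- `f^{(n)} ≡ X^{q^n} (mod 𝓂)`. [folklore] -/
theorem map_residue_ltPolyIter (hπ : π ∈ 𝓂[F]) (n : ℕ) :
    (ltPolyIter F π n).map (IsLocalRing.residue 𝒪[F]) = X ^ residueFieldCard F ^ n := by
  induction n with
  | zero => simp [ltPolyIter_zero]
  | succ n ih =>
    rw [ltPolyIter_succ, Polynomial.map_comp, ih, map_residue_ltPoly π hπ, X_pow_comp, ← pow_mul,
      ← pow_succ]

/-- `f^{(n)}` is monic of degree `q^n`. [folklore] -/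
theorem monic_ltPolyIter (n : ℕ) :
    (ltPolyIter F π n).Monic ∧ (ltPolyIter F π n).natDegree = residueFieldCard F ^ n := by
  have hq : 1 < residueFieldCard F := one_lt_residueFieldCard F
  induction n with
  | zero => exact ⟨monic_X, by simp [ltPolyIter_zero]⟩
  | succ n ih =>
    have hf : (ltPoly F π).Monic ∧ (ltPoly F π).natDegree = residueFieldCard F := by
      have hlt : (C π * X).degree < (X ^ residueFieldCard F : 𝒪[F][X]).degree := by
        rw [degree_X_pow]
        refine (degree_C_mul_X_le π).trans_lt ?_
        exact_mod_cast hq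
      refine ⟨?_, ?_⟩
      · rw [ltPoly, Monic, leadingCoeff_add_of_degree_lt hlt, leadingCoeff_X_pow]
      · rw [ltPoly, natDegree_add_eq_right_of_degree_lt hlt, natDegree_X_pow]
    refine ⟨?_, ?_⟩
    · rw [ltPolyIter_succ]
      exact hf.1.comp ih.1 (by rw [ih.2]; exact pow_ne_zero _ (by omega))
    · rw [ltPolyIter_succ, natDegree_comp, hf.2, ih.2, pow_succ, mul_comm]

/-- `f^{(n)}` has no constant term. [folklore] -/
theorem coeff_zero_ltPolyIter (n : ℕ) : (ltPolyIter F π n).coeff 0 = 0 := by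
  induction n with
  | zero => simp [ltPolyIter_zero]
  | succ n ih =>
    rw [ltPolyIter_succ_eq_mul, mul_coeff_zero, ih, zero_mul]

/-- `φ_{n+1}` is monic of degree `(q-1) q^n` with constant term `π`.
[cite: CasselsFrohlichANT1967, Ch. VI §3.6 Prop. 6 (proof)] -/
theorem monic_ltPolyDiv (n : ℕ) :
    (ltPolyDiv F π n).Monic ∧ (ltPolyDiv F π n).natDegree =
      (residueFieldCard F - 1) * residueFieldCard F ^ n ∧ (ltPolyDiv F π n).coeff 0 = π := by
  have hq : 1 < residueFieldCard F := one_lt_residueFieldCard F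
  obtain ⟨hm, hd⟩ := monic_ltPolyIter π n
  have hm' : (ltPolyIter F π n ^ (residueFieldCard F - 1)).Monic := hm.pow _
  have hd' : (ltPolyIter F π n ^ (residueFieldCard F - 1)).natDegree =
      (residueFieldCard F - 1) * residueFieldCard F ^ n := by
    rw [hm.natDegree_pow, hd]
  have hpos : 0 < (residueFieldCard F - 1) * residueFieldCard F ^ n :=
    Nat.mul_pos (by omega) (pow_pos (by omega) _)
  have hlt : (C π).degree < (ltPolyIter F π n ^ (residueFieldCard F - 1)).degree := by
    rw [degree_eq_natDegree hm'.ne_zero, hd']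
    exact (degree_C_le).trans_lt (by exact_mod_cast hpos)
  refine ⟨?_, ?_, ?_⟩
  · rw [ltPolyDiv, Monic, add_comm, leadingCoeff_add_of_degree_lt hlt]; exact hm'
  · rw [ltPolyDiv, add_comm, natDegree_add_eq_right_of_degree_lt hlt, hd']
  · rw [ltPolyDiv, coeff_add, coeff_C_zero, coeff_zero_eq_eval_zero, eval_pow,
      ← coeff_zero_eq_eval_zero,
      coeff_zero_ltPolyIter, zero_pow (by omega), zero_add]

/-- `φ_{n+1} ≡ X^{(q-1)q^n} (mod 𝓂)`. [folklore] -/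
theorem map_residue_ltPolyDiv (hπ : π ∈ 𝓂[F]) (n : ℕ) :
    (ltPolyDiv F π n).map (IsLocalRing.residue 𝒪[F]) =
      X ^ ((residueFieldCard F - 1) * residueFieldCard F ^ n) := by
  rw [ltPolyDiv, Polynomial.map_add, Polynomial.map_pow, map_residue_ltPolyIter π hπ, map_C,
    (IsLocalRing.residue_eq_zero_iff π).mpr hπ, C_0, add_zero, ← pow_mul, mul_comm]

/-- **`φ_{n+1}` is an Eisenstein polynomial, hence irreducible over `F`** (Cassels–Fröhlich VI
§3.6, proof of Prop. 6: "`φ = f^{(n)}/f^{(n-1)} = (f^{(n-1)})^{q-1} + π` … is an Eisenstein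
polynomial"). [cite: CasselsFrohlichANT1967, Ch. VI §3.6 Prop. 6 (proof)] -/
theorem irreducible_map_ltPolyDiv (hπ : (valuation F).IsUniformizer (π : F)) (n : ℕ) :
    Irreducible ((ltPolyDiv F π n).map (algebraMap 𝒪[F] F)) := by
  have hπm : π ∈ 𝓂[F] := (mem_maximalIdeal_iff_valuation_lt_one _).mpr hπ.val_lt_one
  obtain ⟨hm, hd, h0⟩ := monic_ltPolyDiv π n
  have hq : 1 < residueFieldCard F := one_lt_residueFieldCard F
  have hpos : 0 < (residueFieldCard F - 1) * residueFieldCard F ^ n :=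
    Nat.mul_pos (by omega) (pow_pos (by omega) _)
  rw [← hm.irreducible_iff_irreducible_map_fraction_map]
  refine irreducible_of_eisenstein_criterion (IsLocalRing.maximalIdeal.isMaximal 𝒪[F]).isPrime
    ?_ (fun k hk => ?_) ?_ ?_ hm.isPrimitive
  · rw [hm.leadingCoeff]
    exact fun h => (IsLocalRing.maximalIdeal.isMaximal 𝒪[F]).ne_top
      (Ideal.eq_top_of_isUnit_mem _ h isUnit_one)
  · -- coefficients below the degree reduce to `0` modulo `𝓂`
    rw [degree_eq_natDegree hm.ne_zero, hd, Nat.cast_lt] at hk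
    rw [← IsLocalRing.residue_eq_zero_iff, ← Polynomial.coeff_map, map_residue_ltPolyDiv π hπm,
      coeff_X_pow, if_neg hk.ne]
  · rw [degree_eq_natDegree hm.ne_zero, hd]; exact_mod_cast hpos
  · rw [h0]
    intro hmem
    have key : ∀ x ∈ 𝓂[F] ^ 2, valuation F (x : F) ≤ valuation F (π : F) * valuation F (π : F) := by
      intro x hx
      rw [pow_two] at hx
      refine Submodule.mul_induction_on hx (fun a ha b hb => ?_) (fun a b ha hb => ?_)
      · rw [Subring.coe_mul, Valuation.map_mul]
        have hle : ∀ y ∈ 𝓂[F], valuation F (y : F) ≤ valuation F (π : F) := fun y hy => by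
          rw [show valuation F (π : F) = unifValue F from hπ]
          exact (valuation_le_unifValue_iff_lt_one F _).mpr
            ((mem_maximalIdeal_iff_valuation_lt_one _).mp hy)
        exact mul_le_mul' (hle a ha) (hle b hb)
      · rw [Subring.coe_add]
        exact (Valuation.map_add _ _ _).trans (max_le ha hb)
    have h1 := key π hmem
    have hc0 : valuation F (π : F) ≠ 0 := hπ.val_ne_zero
    have h2 : valuation F (π : F) * 1 ≤ valuation F (π : F) * valuation F (π : F) := by
      rwa [mul_one]
    exact absurd (le_of_mul_le_mul_left h2 (zero_lt_iff.mpr hc0)) (not_le.mpr hπ.val_lt_one)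

/-! ### The Lubin–Tate fields `K_π^n = F(λ_n)` -/

/-- `φ_{n+1}` is non-constant. [folklore] -/
theorem degree_map_ltPolyDiv_ne_zero (n : ℕ) :
    ((ltPolyDiv F π n).map (algebraMap 𝒪[F] F)).degree ≠ 0 := by
  rw [(monic_ltPolyDiv π n).1.degree_map, degree_eq_natDegree (monic_ltPolyDiv π n).1.ne_zero,
    (monic_ltPolyDiv π n).2.1]
  have hq : 1 < residueFieldCard F := one_lt_residueFieldCard F
  exact_mod_cast (Nat.mul_pos (by omega) (pow_pos (by omega) _)).ne'

/-- A root `λ_{n+1} ∈ F̄` of the Eisenstein polynomial `φ_{n+1}` (a primitive `π^{n+1}`-division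
point of the Lubin–Tate formal group of `f = πX + X^q`).
[cite: CasselsFrohlichANT1967, Ch. VI §3.6 Prop. 6 (proof)] -/
def ltRoot (n : ℕ) : AlgebraicClosure F :=
  Classical.choose (IsAlgClosed.exists_aeval_eq_zero (AlgebraicClosure F)
    ((ltPolyDiv F π n).map (algebraMap 𝒪[F] F)) (degree_map_ltPolyDiv_ne_zero π n))

/-- `λ_{n+1}` is a root of `φ_{n+1}`. [folklore] -/
theorem aeval_ltRoot (n : ℕ) :
    aeval (ltRoot π n) ((ltPolyDiv F π n).map (algebraMap 𝒪[F] F)) = 0 :=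
  Classical.choose_spec (IsAlgClosed.exists_aeval_eq_zero (AlgebraicClosure F)
    ((ltPolyDiv F π n).map (algebraMap 𝒪[F] F)) (degree_map_ltPolyDiv_ne_zero π n))

/-- The Lubin–Tate field `K_π^{n+1} = F(λ_{n+1}) ⊆ F̄`.
[cite: CasselsFrohlichANT1967, Ch. VI §3.6] -/
abbrev ltField (n : ℕ) : IntermediateField F (AlgebraicClosure F) :=
  IntermediateField.adjoin F {ltRoot π n}

/-- The minimal polynomial of `λ_{n+1}` over `F` is `φ_{n+1}` (Eisenstein, irreducible).
[cite: CasselsFrohlichANT1967, Ch. VI §3.6 Prop. 6 (proof)] -/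
theorem minpoly_ltRoot (hπ : (valuation F).IsUniformizer (π : F)) (n : ℕ) :
    minpoly F (ltRoot π n) = (ltPolyDiv F π n).map (algebraMap 𝒪[F] F) :=
  (minpoly.eq_of_irreducible_of_monic (irreducible_map_ltPolyDiv π hπ n) (aeval_ltRoot π n)
    ((monic_ltPolyDiv π n).1.map _)).symm

/-- `λ_{n+1}` is integral over `F`. [folklore] -/
theorem isIntegral_ltRoot (n : ℕ) : IsIntegral F (ltRoot π n) :=
  Algebra.IsIntegral.isIntegral _

/-- `K_π^{n+1}/F` is finite. [folklore] -/
instance finiteDimensional_ltField (n : ℕ) : FiniteDimensional F (ltField π n) :=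
  IntermediateField.adjoin.finiteDimensional (isIntegral_ltRoot π n)

/-- **`[K_π^{n+1} : F] = (q - 1) q^n`** (Cassels–Fröhlich VI §3.6, proof of Prop. 6).
[cite: CasselsFrohlichANT1967, Ch. VI §3.6 Prop. 6 (proof)] -/
theorem finrank_ltField (hπ : (valuation F).IsUniformizer (π : F)) (n : ℕ) :
    Module.finrank F (ltField π n) = (residueFieldCard F - 1) * residueFieldCard F ^ n := by
  rw [IntermediateField.adjoin.finrank (isIntegral_ltRoot π n), minpoly_ltRoot π hπ n,
    (monic_ltPolyDiv π n).1.natDegree_map, (monic_ltPolyDiv π n).2.1]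

/-- **`π` is a norm from `K_π^{n+1}`**: `N(-λ_{n+1}) = π` (Cassels–Fröhlich VI §3.6, Cor. to
Prop. 6: "the polynomial `φ` is monic and ends with `π`; hence `N(-α) = π`").
[cite: CasselsFrohlichANT1967, Ch. VI §3.6 Cor. to Prop. 6] -/
theorem norm_neg_gen_ltField (hπ : (valuation F).IsUniformizer (π : F)) (n : ℕ) :
    Algebra.norm F (-IntermediateField.AdjoinSimple.gen F (ltRoot π n)) = (π : F) := by
  have hint := isIntegral_ltRoot π n
  have h := Algebra.PowerBasis.norm_gen_eq_coeff_zero_minpoly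
    (IntermediateField.adjoin.powerBasis hint)
  rw [IntermediateField.adjoin.powerBasis_dim, IntermediateField.adjoin.powerBasis_gen,
    IntermediateField.minpoly_gen, minpoly_ltRoot π hπ n, coeff_map, (monic_ltPolyDiv π n).2.2,
    (monic_ltPolyDiv π n).1.natDegree_map] at h
  have hneg : (-IntermediateField.AdjoinSimple.gen F (ltRoot π n) : ltField π n) =
      algebraMap F (ltField π n) (-1) * IntermediateField.AdjoinSimple.gen F (ltRoot π n) := by
    rw [_root_.map_neg, map_one, neg_one_mul]
  rw [hneg, map_mul, Algebra.norm_algebraMap, IntermediateField.adjoin.finrank hint,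
    minpoly_ltRoot π hπ n, (monic_ltPolyDiv π n).1.natDegree_map, h, ← mul_assoc, ← mul_pow,
    neg_one_mul, neg_neg, one_pow, one_mul]
  rfl

/-- **`π ∈ N(K_π^{n+1}ˣ)`** (as units of `F`).
[cite: CasselsFrohlichANT1967, Ch. VI §3.6 Cor. to Prop. 6] -/
theorem mem_range_norm_ltField (hπ : (valuation F).IsUniformizer (π : F)) (hπ0 : (π : F) ≠ 0)
    (n : ℕ) : Units.mk0 (π : F) hπ0 ∈
      (Units.map (Algebra.norm F : ltField π n →* F)).range := by
  have hgen0 : (-IntermediateField.AdjoinSimple.gen F (ltRoot π n) : ltField π n) ≠ 0 := by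
    intro h0
    have := norm_neg_gen_ltField π hπ n
    rw [h0, Algebra.norm_zero] at this
    exact hπ0 this.symm
  exact ⟨Units.mk0 _ hgen0, Units.ext (by simp [norm_neg_gen_ltField π hπ n])⟩

end LocalField

end Literature.NumberTheory.GaloisRepresentations
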